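import Summits.PneNP.PneNP.Theorems.ChebyshevTracialDesignBlockDecomposition
import Summits.PneNP.PneNP.Theorems.ChebyshevTracialDesignExtendedSign
import HarnessLib

/-!
# Cell pnp-psdrank, route `ChebyshevTracialDesign`: the SIGN ⊕ DOMINATION ⊕ JUNK price list with the SIGN cell at ALL Gram degrees `≤ c'/2`
# and an operator-norm tolerance (crux `TracialDecayExp20`, stmt-PneNP-19878)

Brick 88c (prover g17; MEMO-20 §1–§2). Brick 88 (`…BlockDecomposition.value_le_of_threeBlocks`) prices a psd splitting `X = A Aᵀ + X₂ + X₃` of the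
cut side with the SIGN block restricted to Johnson degree `k ≤ D/2` (brick 23). Brick 90 (`…ExtendedSign.value_le_of_lowDegree_allModes`) removed the
design degree from the SIGN cell (`2k ≤ c'`, at the price of brick 20's tail), and brick 88 §5 (`value_le_of_opNorm_close`) made every cell
tolerant to operator-norm perturbations. This file states the resulting price list by name:
**`value_le_of_fourParts`** — for `n` even, an exact design `(n, t = 2c'+1, T, D, B_v, C, w)` with `D ≤ 2c'`, `5D ≤ 2c'+2`, `2c'+5D ≤ n`, and a cut
side `X = A Aᵀ + X₂ + X₃ + E` where
* `A` has Johnson degree `≤ k` with `D ≤ 2k ≤ c'` and `A Aᵀ ⪯ I` (SIGN at any degree up to `c'/2`),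
* `X₂` is a psd-contraction family well-conditioned against the contraction-valued matching side `Y` (`Σ_{|U|=t}X₂ ⪰ μC(n,t)I`, `Σ_M Y ⪰ ν|PM|I`,
  `μν ≥ 64/n`; DOMINATION),
* `X₃` is any psd family of slice trace mass `Σ_U tr X₃_U ≤ mass·#{t-cuts}` (JUNK),
* `−η·I ⪯ E_U ⪯ η·I` (operator-norm slack),
the design value is at most `r·(B_v√P_D + 2^{2k+1}√P_{2k} + Σ_{κ∈(D/2,k]}R_κ√A_κ) + r·B_v√P_D + B_v·mass + B_v·η·r`.
So the crux's open content, by name: does every contraction field split this way — against the projection field of brick 86, with blocks allowed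
to depend on it (bricks 88b/90b for the SIGN block) — with `mass, η ≤ e^{−aD}/(4B_v)`? (MEMO-20 §4.)
[cite: Grigoriev2001, Lemma 1.4 (PDF p. 8)] [cite: Rothvoss2017, §2 (PDF p. 6)] [cite: GriblingDelaatLaurent2019, §5]
[cite: BrietDadushPokutta2014, Thm. 6 (§3)] [cite: CoppersmithRivlin1992, Thm. (p. 970)]
Stature: support/instrument (composition; kernel lane, no defs, axioms standard). WHAT THIS IS NOT: no decomposition theorem, no proof or refutation
of the crux, nothing on psd rank of P_PM(K_n), no P-vs-NP content. Supports stmt-PneNP-19878.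
-/

set_option linter.dupNamespace false -- `Summit.PneNP.PneNP.…`: summit = sub-problem (D-0017)

noncomputable section

namespace Summit.PneNP.PneNP.Theorems.ChebyshevTracialDesignBlockDecompositionAllModes

open Finset Matrix Literature.Barriers.PneNP Literature.Combinatorics.Optimization
open Summit.PneNP.PneNP.Theorems.ChebyshevTracialDesignBlockDecomposition
open Summit.PneNP.PneNP.Theorems.ChebyshevTracialDesignExtendedSign (value_le_of_lowDegree_allModes)
open Summit.PneNP.PneNP.Theorems.ChebyshevTracialDesignWellConditionedDensity (value_le_tail_of_minDensity)

variable {n r : ℕ}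

/-- **SIGN (any degree ≤ c'/2) ⊕ DOMINATION ⊕ JUNK ⊕ operator-norm slack.** See the file header for the reading.
[cite: Grigoriev2001, Lemma 1.4 (PDF p. 8)] [cite: Rothvoss2017, §2 (PDF p. 6)] [cite: GriblingDelaatLaurent2019, §5]
[cite: BrietDadushPokutta2014, Thm. 6 (§3)] -/
theorem value_le_of_fourParts {c' T D m k : ℕ} {Bv mass η : ℝ} {C : Finset ℕ} {w : ℕ → ℝ} (hn : Even n)
    (hdes : IsExactDesign n (2 * c' + 1) T D Bv C w) (hD : D ≤ 2 * c') (hD1 : 5 * D ≤ 2 * c' + 2) (hD2 : 2 * c' + 5 * D ≤ n)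
    (hDk : D ≤ 2 * k) (hkc : 2 * k ≤ c')
    (A : OddSet n → Matrix (Fin r) (Fin m) ℝ) (hA : IsLowDegreeU n k A) (hA1 : ∀ U, (1 - A U * (A U)ᵀ).PosSemidef)
    (X₂ X₃ E : OddSet n → Matrix (Fin r) (Fin r) ℝ) (Y : PMatch n → Matrix (Fin r) (Fin r) ℝ)
    (hX₂ : ∀ U, (X₂ U).PosSemidef ∧ (1 - X₂ U).PosSemidef) (hX₃ : ∀ U, (X₃ U).PosSemidef)
    (hη : 0 ≤ η) (hE : ∀ U, (η • (1 : Matrix (Fin r) (Fin r) ℝ) - E U).PosSemidef ∧ (η • (1 : Matrix (Fin r) (Fin r) ℝ) + E U).PosSemidef)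
    (hY : ∀ M, (Y M).PosSemidef ∧ (1 - Y M).PosSemidef)
    {μ ν : ℝ} (hμ : 0 < μ) (hν : 0 < ν) (hμν : 64 / (n : ℝ) ≤ μ * ν)
    (hXbar : ((∑ U : OddSet n, if U.1.card = 2 * c' + 1 then X₂ U else 0) -
      (μ * (n.choose (2 * c' + 1) : ℝ)) • (1 : Matrix (Fin r) (Fin r) ℝ)).PosSemidef)
    (hYbar : ((∑ M, Y M) - (ν * (Fintype.card (PMatch n) : ℝ)) • (1 : Matrix (Fin r) (Fin r) ℝ)).PosSemidef)
    (hmass0 : 0 ≤ mass)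
    (hmass : ∑ U, (X₃ U).trace ≤ mass * ((univ.filter fun U' : OddSet n => U'.1.card = 2 * c' + 1).card : ℝ)) :
    ∑ U : OddSet n, ∑ M : PMatch n, levelWeight n (2 * c' + 1) C w U M * ((A U * (A U)ᵀ + X₂ U + X₃ U + E U) * Y M).trace ≤
      (r : ℝ) * (Bv * Real.sqrt (∏ i ∈ range (D / 2 + 1), ((2 * i + 1 : ℝ) / ((n : ℝ) - 2 * i))) +
          2 ^ (2 * k + 1) * Real.sqrt (∏ i ∈ range (k + 1), ((2 * i + 1 : ℝ) / ((n : ℝ) - 2 * i))) +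
          ∑ κ ∈ Ico (D / 2 + 1) (k + 1),
            (∏ i ∈ range κ, (((2 * c' + 1 : ℝ) - 2 * i) * ((n : ℝ) - 2 * c' - 1 - 2 * i) /
                (((2 * c' : ℝ) - 2 * i) * ((n : ℝ) - 2 * c' - 2 - 2 * i)))) *
              Real.sqrt (∏ i ∈ range κ, ((2 * i + 1 : ℝ) / ((n : ℝ) - 2 * i)))) +
        (r : ℝ) * ((∑ c ∈ C, |w c|) * Real.sqrt (∏ i ∈ range (D / 2 + 1), ((2 * i + 1 : ℝ) / ((n : ℝ) - 2 * i)))) +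
        (∑ c ∈ C, |w c|) * mass + (∑ c ∈ C, |w c|) * η * r := by
  rw [value_add_left, value_add_left, value_add_left]
  have h1 := value_le_of_lowDegree_allModes hn hdes hD hDk hkc A hA hA1 Y hY
  have h2 := value_le_tail_of_minDensity hn hdes hD hD1 hD2 X₂ Y hX₂ hY hμ hν hμν hXbar hYbar
  have h3 := value_le_absVar_mul_traceMass (2 * c' + 1) C w X₃ hX₃ Y hY
  have h4 := (abs_le.1 (abs_value_le_of_opNorm (2 * c' + 1) C w hη E hE Y hY)).2
  -- the junk bound `(Σ|w|)/#cuts · Σ tr X₃ ≤ (Σ|w|)·mass`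
  set N : ℝ := ((univ.filter fun U' : OddSet n => U'.1.card = 2 * c' + 1).card : ℝ) with hN
  have hw : 0 ≤ ∑ c ∈ C, |w c| := sum_nonneg fun c _ => abs_nonneg _
  have h3' : (∑ c ∈ C, |w c|) / N * ∑ U, (X₃ U).trace ≤ (∑ c ∈ C, |w c|) * mass := by
    rcases eq_or_lt_of_le (show (0 : ℝ) ≤ N by positivity) with hN0 | hNpos
    · rw [← hN0, div_zero, zero_mul]
      exact mul_nonneg hw hmass0
    · rw [div_mul_eq_mul_div, div_le_iff₀ hNpos]
      calc (∑ c ∈ C, |w c|) * ∑ U, (X₃ U).trace ≤ (∑ c ∈ C, |w c|) * (mass * N) := mul_le_mul_of_nonneg_left hmass hw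
        _ = (∑ c ∈ C, |w c|) * mass * N := by ring
  linarith

end Summit.PneNP.PneNP.Theorems.ChebyshevTracialDesignBlockDecompositionAllModes

end
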